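import Literature.NumberTheory.Sieve.ChenTwinSieveUpperSum
import HarnessLib

/-!
# Route `ParityWeightedChenSwitching` — crux `ParityChenInequality` (stmt-Parity-18666): the prime sum at level `0.499`

The prime sum of the upper-sieve step (B) of Chen's chain (Nathanson, *Additive Number Theory*, proof of
Thm 10.5, pp. 174–175) at the FIXED sieve level `D = x^{0.499}` instead of `x^{1/2 − h}`: for every
`ε₁ > 0` there is `0 < h ≤ 1/48` such that for all large `x`,

  `∑_{x^{1/8} ≤ q < y(x), q prime} (1/(q−1)) · (1/4)/(0.499 − log q/log x)
      ≤ (1/4) · (log((1/3)/(0.499 − 1/3)) − log((1/8)/(0.499 − 1/8)))/0.499 + ε₁`,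

the right side being `(1/4) ∫_{1/8}^{1/3} dt/(t(0.499 − t))` in closed form. The proof is the tree's
`Literature.NumberTheory.Sieve.Chen.sum_primesIco_weight_le` (the case `c = 1/2 − h`) verbatim with the block
majorant constant `c' = 0.499 − h`: cut `[x^{1/8}, x^{1/3+h})` into `K + 1` blocks `[x^{tᵢ}, x^{tᵢ₊₁})`,
`tᵢ = 1/8 + ih`, `h = 5/(24K)`; on a block the weight is `≤ (1/4)/(c' − tᵢ)` and `∑ 1/(q−1) ≤ η + log(tᵢ₊₁/tᵢ)`
(Mertens, `exists_sum_inv_sub_one_le`); the telescoping inequality `log(b/a)/(c' − a) ≤ G(b) − G(a)`,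
`G(t) = log(t/(c'−t))/c'` (`log_div_div_le_sub`) bounds the block sum by
`Ψ(h) = G(1/3 + h) − G(1/8) → (log((1/3)/(0.499−1/3)) − log((1/8)/(0.499−1/8)))/0.499` as `h → 0`.
No definitions (the functions `Ψ`, `tᵢ` are written out).

References: [Nathanson1996] §10.5 (proof of Thm 10.5, pp. 174–175); [HardyWright2008] Thm 429 (Mertens).
-/

namespace Summit.Parity.GeneralizedHardyLittlewood.Theorems

open Finset Filter Topology
open Literature.NumberTheory.Sieve Literature.NumberTheory.Sieve.Chen
  Literature.NumberTheory.Sieve.ChenSieve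

/-- Continuity gives: for every `ε > 0` there is `ρ > 0` such that for `0 ≤ h < ρ`,
`Ψ(h) = (0.499 − h)⁻¹ (log((1/3+h)/(0.499 − 1/3 − 2h)) − log((1/8)/(0.499 − 1/8 − h)))
  ≤ (log((1/3)/(0.499−1/3)) − log((1/8)/(0.499−1/8)))/0.499 + ε`. -/
theorem exists_upperSumPsi_le {ε : ℝ} (hε : 0 < ε) :
    ∃ ρ : ℝ, 0 < ρ ∧ ∀ h : ℝ, 0 ≤ h → h < ρ →
      (0.499 - h)⁻¹ * (Real.log ((1 / 3 + h) / (0.499 - 1 / 3 - 2 * h)) -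
          Real.log ((1 / 8) / (0.499 - 1 / 8 - h))) ≤
        (Real.log ((1 / 3) / (0.499 - 1 / 3)) - Real.log ((1 / 8) / (0.499 - 1 / 8))) / 0.499 + ε := by
  set Ψ : ℝ → ℝ := fun h => (0.499 - h)⁻¹ * (Real.log ((1 / 3 + h) / (0.499 - 1 / 3 - 2 * h)) -
    Real.log ((1 / 8) / (0.499 - 1 / 8 - h))) with hΨ
  have hcont : ContinuousAt Ψ 0 := by
    simp only [hΨ]
    fun_prop (disch := norm_num)
  have hΨ0 : Ψ 0 = (Real.log ((1 / 3) / (0.499 - 1 / 3)) - Real.log ((1 / 8) / (0.499 - 1 / 8))) / 0.499 := by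
    simp only [hΨ, add_zero, mul_zero, sub_zero]
    rw [inv_mul_eq_div]
  obtain ⟨ρ, hρ, hρ'⟩ := Metric.tendsto_nhds_nhds.mp hcont ε hε
  refine ⟨ρ, hρ, fun h h0 hhρ => ?_⟩
  have := hρ' (x := h) (by rwa [dist_zero_right, Real.norm_of_nonneg h0])
  rw [hΨ0, Real.dist_eq] at this
  change Ψ h ≤ _
  linarith [(abs_lt.mp this).2]

/-- The telescoped block sum at level `0.499`: for `K ≥ 10`, `h = 5/(24K)`, `tᵢ = 1/8 + ih`,
`c' = 0.499 − h`, `∑_{i ≤ K} log(tᵢ₊₁/tᵢ)/(c' − tᵢ) ≤ Ψ(h)`. -/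
theorem sum_blocks_le_upperSumPsi {K : ℕ} (hK : 10 ≤ K) :
    ∑ i ∈ Finset.range (K + 1),
        Real.log ((1 / 8 + (i + 1 : ℕ) * (5 / (24 * (K : ℝ)))) / (1 / 8 + i * (5 / (24 * (K : ℝ))))) /
          ((0.499 - 5 / (24 * (K : ℝ))) - (1 / 8 + i * (5 / (24 * (K : ℝ))))) ≤
      (0.499 - 5 / (24 * (K : ℝ)))⁻¹ *
        (Real.log ((1 / 3 + 5 / (24 * (K : ℝ))) / (0.499 - 1 / 3 - 2 * (5 / (24 * (K : ℝ))))) -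
          Real.log ((1 / 8) / (0.499 - 1 / 8 - 5 / (24 * (K : ℝ))))) := by
  set h := 5 / (24 * (K : ℝ)) with hh
  have hK0 : (10 : ℝ) ≤ K := by exact_mod_cast hK
  have hKpos : (0 : ℝ) < K := by linarith
  have hh0 : 0 < h := by positivity
  have hh1 : h ≤ 1 / 48 := by
    rw [hh, div_le_iff₀ (by positivity)]; linarith
  set c := (0.499 : ℝ) - h with hc
  set t : ℕ → ℝ := fun i => 1 / 8 + i * h with ht
  set G : ℕ → ℝ := fun i => Real.log (t i / (c - t i)) / c with hG
  have hKh : (K : ℝ) * h = 5 / 24 := by rw [hh]; field_simp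
  -- termwise telescoping bound
  have hterm : ∀ i ∈ Finset.range (K + 1),
      Real.log (t (i + 1) / t i) / (c - t i) ≤ G (i + 1) - G i := by
    intro i hi
    have hiK : (i : ℝ) ≤ K := by exact_mod_cast Nat.lt_succ_iff.mp (Finset.mem_range.mp hi)
    have hti : 0 < t i := by simp only [ht]; positivity
    have htt : t i ≤ t (i + 1) := by simp only [ht]; push_cast; nlinarith
    have htc : t (i + 1) < c := by
      simp only [ht, hc]; push_cast
      have : ((i : ℝ) + 1) * h ≤ (K + 1) * h := by gcongr
      have h499 : (0.499 : ℝ) = 499 / 1000 := by norm_num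
      rw [h499]
      nlinarith
    have := log_div_div_le_sub hti htt htc
    simp only [hG]
    rwa [sub_div] at this
  calc ∑ i ∈ Finset.range (K + 1), Real.log (t (i + 1) / t i) / (c - t i)
      ≤ ∑ i ∈ Finset.range (K + 1), (G (i + 1) - G i) := Finset.sum_le_sum hterm
    _ = G (K + 1) - G 0 := Finset.sum_range_sub G (K + 1)
    _ = c⁻¹ * (Real.log ((1 / 3 + h) / (0.499 - 1 / 3 - 2 * h)) -
          Real.log ((1 / 8) / (0.499 - 1 / 8 - h))) := by
        simp only [hG, ht, hc]
        have e1 : (1 : ℝ) / 8 + ((K + 1 : ℕ) : ℝ) * h = 1 / 3 + h := by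
          push_cast; linarith [hKh]
        have e2 : (0.499 : ℝ) - h - (1 / 3 + h) = 0.499 - 1 / 3 - 2 * h := by ring
        have e3 : (1 : ℝ) / 8 + ((0 : ℕ) : ℝ) * h = 1 / 8 := by simp
        have e4 : (0.499 : ℝ) - h - 1 / 8 = 0.499 - 1 / 8 - h := by ring
        rw [e1, e2, e3, e4]
        ring

set_option maxHeartbeats 400000 in
/-- **The prime sum of Theorem 10.5 at level `0.499`.** For every `ε₁ > 0` there is `0 < h ≤ 1/48`
such that for all large `x`,
`∑_{x^{1/8} ≤ q < y(x), q prime} (1/(q−1)) · (1/4)/(0.499 − log q/log x)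
  ≤ (1/4)(log((1/3)/(0.499−1/3)) − log((1/8)/(0.499−1/8)))/0.499 + ε₁`
(Nathanson pp. 174–175 with `x^{0.499}` for `N^{1/2}(log N)^{−B}`:
`(1/4)∑_{z ≤ q < y} log x/(φ(q) log(x^{0.499}/q)) = (1/4)(∫_{1/8}^{1/3} dα/(α(0.499 − α)) + o(1))`). -/
theorem sum_primesIco_weight_le_level0499 {ε₁ : ℝ} (hε₁ : 0 < ε₁) :
    ∃ h : ℝ, 0 < h ∧ h ≤ 1 / 48 ∧ ∀ᶠ x : ℕ in atTop,
      ∑ q ∈ primesIco (twinZ x) (twinY x),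
          1 / ((q : ℝ) - 1) * ((1 / 4) / (0.499 - Real.log q / Real.log x)) ≤
        (1 / 4) * ((Real.log ((1 / 3) / (0.499 - 1 / 3)) - Real.log ((1 / 8) / (0.499 - 1 / 8))) / 0.499) +
          ε₁ := by
  obtain ⟨ρ, hρ, hΨ⟩ := exists_upperSumPsi_le (show 0 < 2 * ε₁ by positivity)
  set K : ℕ := ⌈5 / (24 * ρ)⌉₊ + 10 with hKdef
  have hK10 : 10 ≤ K := by omega
  have hKreal : (10 : ℝ) ≤ K := by exact_mod_cast hK10
  have hKpos : (0 : ℝ) < K := by linarith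
  set h := 5 / (24 * (K : ℝ)) with hh
  have hh0 : 0 < h := by positivity
  have hh1 : h ≤ 1 / 48 := by rw [hh, div_le_iff₀ (by positivity)]; linarith
  have hhρ : h < ρ := by
    rw [hh, div_lt_iff₀ (by positivity)]
    have h1 : 5 / (24 * ρ) ≤ ⌈5 / (24 * ρ)⌉₊ := Nat.le_ceil _
    have h2 : ((⌈5 / (24 * ρ)⌉₊ : ℕ) : ℝ) + 10 = K := by rw [hKdef]; push_cast; ring
    rw [div_le_iff₀ (by positivity)] at h1
    nlinarith
  set Λ := (Real.log ((1 / 3) / (0.499 - 1 / 3)) - Real.log ((1 / 8) / (0.499 - 1 / 8))) / 0.499 with hΛ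
  have hΨh : (0.499 - h)⁻¹ * (Real.log ((1 / 3 + h) / (0.499 - 1 / 3 - 2 * h)) -
      Real.log ((1 / 8) / (0.499 - 1 / 8 - h))) ≤ Λ + 2 * ε₁ := hΨ h hh0.le hhρ
  have hKh : (K : ℝ) * h = 5 / 24 := by rw [hh]; field_simp
  set η := ε₁ / (4 * ((K : ℝ) + 1)) with hη
  have hη0 : 0 < η := by positivity
  obtain ⟨u₀, hu₀3, hMert⟩ := exists_sum_inv_sub_one_le hη0
  -- block boundaries
  set t : ℕ → ℝ := fun i => 1 / 8 + i * h with ht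
  set c := (0.499 : ℝ) - h with hc
  have ht0 : t 0 = 1 / 8 := by simp [ht]
  have htK1 : t (K + 1) = 1 / 3 + h := by simp only [ht]; push_cast; linarith [hKh]
  have htmono : ∀ i : ℕ, t i < t (i + 1) := fun i => by simp only [ht]; push_cast; nlinarith
  have htmono' : ∀ i j : ℕ, i ≤ j → t i ≤ t j := fun i j hij => by
    simp only [ht]
    have : (i : ℝ) ≤ j := by exact_mod_cast hij
    nlinarith
  have hct : ∀ i : ℕ, i ≤ K → 1 / 8 ≤ c - t i := fun i hi => by
    have := htmono' i K hi
    have htK : t K = 1 / 3 := by simp only [ht]; linarith [hKh]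
    have h499 : (0.499 : ℝ) = 499 / 1000 := by norm_num
    rw [hc, h499]; linarith
  refine ⟨h, hh0, hh1, ?_⟩
  have hE1 : ∀ᶠ x : ℕ in atTop, u₀ ≤ (x : ℝ) ^ (1 / 8 : ℝ) :=
    ((tendsto_rpow_atTop (by norm_num : (0 : ℝ) < 1 / 8)).comp
      tendsto_natCast_atTop_atTop).eventually_ge_atTop _
  filter_upwards [hE1, eventually_twinY_le_rpow_third_add hh0, eventually_ge_atTop 3] with x hxu₀ hxy hx3
  have hx1 : (1 : ℝ) < x := by exact_mod_cast (show 1 < x by omega)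
  have hx0 : (0 : ℝ) < x := by linarith
  have hLx : 0 < Real.log x := Real.log_pos hx1
  -- the blocks
  set B : ℕ → Finset ℕ := fun i =>
    (Nat.primesBelow ⌈(x : ℝ) ^ t (i + 1)⌉₊).filter (fun p : ℕ => (x : ℝ) ^ t i ≤ (p : ℝ)) with hB
  have hlogrpow : ∀ s : ℝ, Real.log ((x : ℝ) ^ s) = s * Real.log x := fun s => Real.log_rpow hx0 s
  -- membership consequences
  have hBmem : ∀ i q, q ∈ B i → q.Prime ∧ (x : ℝ) ^ t i ≤ q ∧ (q : ℝ) < (x : ℝ) ^ t (i + 1) := by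
    intro i q hq
    simp only [hB, Finset.mem_filter, Nat.mem_primesBelow, Nat.lt_ceil] at hq
    exact ⟨hq.1.2, hq.2, hq.1.1⟩
  have hBlog : ∀ i q, q ∈ B i → Real.log q / Real.log x < t (i + 1) := by
    intro i q hq
    obtain ⟨hq, -, hlt⟩ := hBmem i q hq
    have hq0 : (0 : ℝ) < q := by exact_mod_cast hq.pos
    rw [div_lt_iff₀ hLx, ← hlogrpow]
    exact Real.log_lt_log hq0 hlt
  -- (a) cover
  have hcover : ∀ q ∈ primesIco (twinZ x) (twinY x), ∃ i ∈ Finset.range (K + 1), q ∈ B i := by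
    intro q hq
    rw [primesIco, Finset.mem_filter, Finset.mem_Ico] at hq
    obtain ⟨⟨hzq, hqy⟩, hqprime⟩ := hq
    have hzq' : (x : ℝ) ^ (1 / 8 : ℝ) ≤ q := twinZ_le_iff.mp hzq
    have hqy' : (q : ℝ) < (x : ℝ) ^ t (K + 1) := by
      rw [htK1]
      calc (q : ℝ) < twinY x := by exact_mod_cast hqy
        _ ≤ _ := hxy
    classical
    have hex : ∃ i, (q : ℝ) < (x : ℝ) ^ t (i + 1) := ⟨K, hqy'⟩
    set i₀ := Nat.find hex with hi₀
    have hi₀spec : (q : ℝ) < (x : ℝ) ^ t (i₀ + 1) := Nat.find_spec hex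
    have hi₀K : i₀ ≤ K := Nat.find_min' hex hqy'
    have hlow : (x : ℝ) ^ t i₀ ≤ q := by
      rcases Nat.eq_zero_or_pos i₀ with h0 | hpos
      · rw [h0, ht0]; exact hzq'
      · obtain ⟨j, hj⟩ : ∃ j, i₀ = j + 1 := ⟨i₀ - 1, by omega⟩
        have hmin := Nat.find_min hex (show j < i₀ by omega)
        rw [hj]
        exact not_lt.mp hmin
    refine ⟨i₀, Finset.mem_range.mpr (by omega), ?_⟩
    simp only [hB, Finset.mem_filter, Nat.mem_primesBelow, Nat.lt_ceil]
    exact ⟨⟨hi₀spec, hqprime⟩, hlow⟩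
  -- (b) nonnegativity on the blocks and the block weight bound
  set f : ℕ → ℝ := fun q => 1 / ((q : ℝ) - 1) * ((1 / 4) / (0.499 - Real.log q / Real.log x))
    with hf
  have hden : ∀ i ∈ Finset.range (K + 1), ∀ q ∈ B i,
      c - t i ≤ 0.499 - Real.log q / Real.log x := by
    intro i hi q hq
    have := hBlog i q hq
    simp only [hc, ht] at this ⊢
    push_cast at this
    linarith
  have hfnn : ∀ i ∈ Finset.range (K + 1), ∀ q ∈ B i, 0 ≤ f q := by
    intro i hi q hq
    have hiK : i ≤ K := Nat.lt_succ_iff.mp (Finset.mem_range.mp hi)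
    have h1 := hden i hi q hq
    have h2 := hct i hiK
    have hq2 : (2 : ℝ) ≤ q := by exact_mod_cast (hBmem i q hq).1.two_le
    simp only [hf]
    exact mul_nonneg (div_nonneg zero_le_one (by linarith)) (div_nonneg (by norm_num) (by linarith))
  have hfle : ∀ i ∈ Finset.range (K + 1), ∀ q ∈ B i,
      f q ≤ (1 / 4) / (c - t i) * (1 / ((q : ℝ) - 1)) := by
    intro i hi q hq
    have hiK : i ≤ K := Nat.lt_succ_iff.mp (Finset.mem_range.mp hi)
    have h1 := hden i hi q hq
    have h2 := hct i hiK
    have hq2 : (2 : ℝ) ≤ q := by exact_mod_cast (hBmem i q hq).1.two_le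
    simp only [hf]
    rw [mul_comm]
    refine mul_le_mul_of_nonneg_right ?_ (div_nonneg zero_le_one (by linarith))
    exact div_le_div_of_nonneg_left (by norm_num) (by linarith) h1
  -- (c) + (d): the block sums
  have hblock : ∀ i ∈ Finset.range (K + 1),
      ∑ q ∈ B i, f q ≤ (1 / 4) / (c - t i) * (η + Real.log (t (i + 1) / t i)) := by
    intro i hi
    have hiK : i ≤ K := Nat.lt_succ_iff.mp (Finset.mem_range.mp hi)
    have hwpos : 0 ≤ (1 / 4) / (c - t i) := div_nonneg (by norm_num) (by linarith [hct i hiK])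
    have hti8 : 1 / 8 ≤ t i := by rw [← ht0]; exact htmono' 0 i (Nat.zero_le i)
    have hu : u₀ ≤ (x : ℝ) ^ t i :=
      hxu₀.trans (Real.rpow_le_rpow_of_exponent_le hx1.le hti8)
    have huw : (x : ℝ) ^ t i < (x : ℝ) ^ t (i + 1) := Real.rpow_lt_rpow_of_exponent_lt hx1 (htmono i)
    have hM := hMert _ _ hu huw
    rw [hlogrpow, hlogrpow, mul_div_mul_right _ _ hLx.ne'] at hM
    calc ∑ q ∈ B i, f q ≤ ∑ q ∈ B i, (1 / 4) / (c - t i) * (1 / ((q : ℝ) - 1)) :=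
          Finset.sum_le_sum (hfle i hi)
      _ = (1 / 4) / (c - t i) * ∑ q ∈ B i, 1 / ((q : ℝ) - 1) := by rw [Finset.mul_sum]
      _ ≤ (1 / 4) / (c - t i) * (η + Real.log (t (i + 1) / t i)) :=
          mul_le_mul_of_nonneg_left hM hwpos
  -- (e) assemble
  have hsumK : ∑ i ∈ Finset.range (K + 1), (1 / 4) / (c - t i) * (η + Real.log (t (i + 1) / t i)) ≤
      (1 / 4) * Λ + ε₁ := by
    have h1 : ∀ i ∈ Finset.range (K + 1), (1 / 4) / (c - t i) * (η + Real.log (t (i + 1) / t i)) ≤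
        2 * η + (1 / 4) * (Real.log (t (i + 1) / t i) / (c - t i)) := by
      intro i hi
      have hiK : i ≤ K := Nat.lt_succ_iff.mp (Finset.mem_range.mp hi)
      have hci := hct i hiK
      have hlog0 : 0 ≤ Real.log (t (i + 1) / t i) := by
        refine Real.log_nonneg ((one_le_div ?_).mpr (htmono i).le)
        have : 1 / 8 ≤ t i := by rw [← ht0]; exact htmono' 0 i (Nat.zero_le i)
        linarith
      have hinv : (1 / 4) / (c - t i) ≤ 2 := by
        rw [div_le_iff₀ (by linarith)]; linarith
      have e : (1 / 4) / (c - t i) * (η + Real.log (t (i + 1) / t i)) =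
          (1 / 4) / (c - t i) * η + (1 / 4) * (Real.log (t (i + 1) / t i) / (c - t i)) := by ring
      rw [e]
      nlinarith
    refine (Finset.sum_le_sum h1).trans ?_
    rw [Finset.sum_add_distrib, Finset.sum_const, Finset.card_range, nsmul_eq_mul, ← Finset.mul_sum]
    have htel := sum_blocks_le_upperSumPsi hK10
    rw [← hh] at htel
    have hteleq : ∑ i ∈ Finset.range (K + 1), Real.log (t (i + 1) / t i) / (c - t i) ≤
        c⁻¹ * (Real.log ((1 / 3 + h) / (0.499 - 1 / 3 - 2 * h)) -
          Real.log ((1 / 8) / (0.499 - 1 / 8 - h))) := by rw [hc]; exact htel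
    have hKη : ((K + 1 : ℕ) : ℝ) * (2 * η) = ε₁ / 2 := by
      rw [hη]; push_cast; field_simp; ring
    rw [hKη]
    linarith [hΨh, hteleq]
  calc ∑ q ∈ primesIco (twinZ x) (twinY x), f q
      ≤ ∑ i ∈ Finset.range (K + 1), ∑ q ∈ B i, f q :=
        sum_le_sum_sum_of_cover _ B _ f hcover hfnn
    _ ≤ ∑ i ∈ Finset.range (K + 1), (1 / 4) / (c - t i) * (η + Real.log (t (i + 1) / t i)) :=
        Finset.sum_le_sum hblock
    _ ≤ (1 / 4) * Λ + ε₁ := hsumK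

end Summit.Parity.GeneralizedHardyLittlewood.Theorems
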